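import Literature.Analysis.FluidPDE.BiotSavartGradientLp
import Literature.Analysis.FluidPDE.LocalHelmholtzSupBound
import HarnessLib

/-!
# The `L^p` div–curl estimate on `ℝ³`

For `1 < p < ∞` the full gradient of a vector field on `ℝ³` is controlled in `L^p` by its
divergence and its curl. This file proves the estimate first for test fields and then, by
truncation, for smooth divergence-free fields in `L^p`:

* `apply_eq_biotSavart_curl_apply_add_convolution` — **the Helmholtz decomposition of a test
  field**, componentwise: `uᵢ = (K₃ ∗ curl u)ᵢ + N[∂ᵢ div u]` for `u ∈ C^∞_c(ℝ³; ℝ³)`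
  (`K₃ ∗ Φ = −Γ ∗ curl Φ`, `curl curl = ∇ div − Δ`, `Γ ∗ Δu = u`; Majda–Bertozzi §2.4.1,
  (2.92)–(2.96));
* `fderiv_apply_eq_fderiv_biotSavart_curl_add` — its derivative,
  `∂ᵥuᵢ = (∂ᵥ K₃ ∗ curl u)ᵢ + N[∂ᵥ∂ᵢ div u]`;
* `exists_eLpNorm_fderiv_apply_le_curl_add_divergence`,
  `exists_eLpNorm_fderiv_le_curl_add_divergence` — **the div–curl estimate for test fields**:
  `‖∂ᵥuᵢ‖_{L^p} ≤ C (‖curl u‖_{L^p} + ‖div u‖_{L^p})` (`|v| ≤ 1`) and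
  `‖Du‖_{L^p} ≤ C (‖curl u‖_{L^p} + ‖div u‖_{L^p})` for all `u ∈ C^∞_c(ℝ³; ℝ³)`, from the
  Calderón–Zygmund bounds for `∇K₃ ∗ ω` (`exists_eLpNorm_fderiv_biotSavart_apply_le_norm`) and
  for `N[∂ᵥ∂ᵤρ]` (`exists_eLpNorm_convolution_mixed_fderiv2_newtonKernel_le`);
* `exists_eLpNorm_fderiv_le_curl_of_isDivFree` — **`‖∇u‖_{L^p} ≤ C_p ‖ω‖_{L^p}` for smooth
  divergence-free fields `u ∈ L^p(ℝ³)`** (Majda–Bertozzi (11.9) with Prop. 10.6: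
  "`‖∇v‖_{L^p} ≤ C_p ‖ω‖_{L^p}`"), by applying the test-field estimate to the truncations
  `χ(·/R) u` (`div (χ_R u) = ⟪u, ∇χ_R⟫`, `curl (χ_R u) = χ_R ω + ∇χ_R × u`, `|∇χ_R| ≤ C/R`) and
  Fatou's lemma in `L^p` as `R → ∞`.

## Mathlib / tree search

Tree: `biotSavart_eq_neg_integral_newtonKernel_smul_curl` (`BiotSavartNewtonKernel`),
`curl_curl_eq_sum_fderiv_divergence_sub_laplacian`, `integral_newtonKernel_smul_laplacian`
(`LocalHelmholtzSupBound`), `exists_eLpNorm_fderiv_biotSavart_apply_le_norm`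
(`BiotSavartGradientLp`), `exists_eLpNorm_convolution_mixed_fderiv2_newtonKernel_le`
(`NewtonPotentialCZTest`), `fderiv_convolution_newtonKernel_apply`,
`contDiff_convolution_newtonKernel`, `convolution_newtonKernel_apply'` (`NewtonPotentialTestSource`),
`fderiv_apply_coord`, `contDiff_apply_coord`, `opNorm_le_sum_abs_coord` (`LocalBiotSavartCalculus`),
`cutoff`, `exists_norm_fderiv_cutoff_le`, `tendsto_cutoff_natCast_add_one`, `divergence_smul_apply`
(`WholeSpaceIBP`), `curl_smul`, `contDiff_curl`, `hasCompactSupport_curl` (`VorticityCalculus`),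
`contDiff_divergence`. Mathlib: `MeasureTheory.Lp.eLpNorm_lim_le_liminf_eLpNorm`,
`eLpNorm_add_le`, `eLpNorm_sum_le`, `eLpNorm_mono_real`, `eLpNorm_const_smul_le`.

## References

* A. J. Majda, A. L. Bertozzi, *Vorticity and incompressible flow* (2002), §2.4.1 Prop. 2.16
  with (2.92)–(2.96) (p. 63–64 of the held text), Prop. 10.6 (Calderón–Zygmund inequality,
  p. 359) and Ch. 11 (11.9)
  (`‖∇v‖_{L^p} ≤ C_p ‖ω‖_{L^p}`, p. 367), §4.2 (p. 144). [MajdaBertozziCUP2002]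
* E. M. Stein, *Singular integrals and differentiability properties of functions* (1971),
  Ch. II §4.2 Thm 3, Ch. III §1.3. [Stein1971]
-/

noncomputable section

open MeasureTheory Set Filter Topology Function Metric ContinuousLinearMap
open scoped ENNReal NNReal Convolution ContDiff RealInnerProductSpace Laplacian

namespace Literature.Analysis.FluidPDE

section DivCurlLp

variable {u : EuclideanSpace ℝ (Fin 3) → EuclideanSpace ℝ (Fin 3)}

/-- The curl of a `C^∞` field is `C^∞`. [folklore] -/
private theorem contDiff_curl_infty (hu : ContDiff ℝ ∞ u) : ContDiff ℝ ∞ (curl u) :=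
  contDiff_curl (n := ⊤) (hu.of_le (by exact_mod_cast le_top))

/-- The divergence of a `C^∞` field is `C^∞`. [folklore] -/
private theorem contDiff_divergence_infty (hu : ContDiff ℝ ∞ u) :
    ContDiff ℝ ∞ (VectorCalculus.divergence u) :=
  contDiff_divergence (n := ⊤) (hu.of_le (by exact_mod_cast le_top))

/-- The divergence of a compactly supported field is compactly supported. [folklore] -/
private theorem hasCompactSupport_divergence_of (huc : HasCompactSupport u) :
    HasCompactSupport (VectorCalculus.divergence u) :=
  huc.mono' fun x hx => by
    contrapose! hx
    simp only [mem_support, not_not]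
    exact divergence_eq_zero_of_notMem_tsupport hx

/-- **The Helmholtz decomposition of a test field, componentwise.** For `u ∈ C^∞_c(ℝ³; ℝ³)`,
every point `y` and component `i`,
`uᵢ(y) = (K₃ ∗ curl u)ᵢ(y) + N[∂ᵢ div u](y)`, `N[s] = Γ ∗ s` the Newtonian potential: from
`K₃ ∗ (curl u) = −Γ ∗ curl curl u` (`biotSavart_eq_neg_integral_newtonKernel_smul_curl`),
`curl curl u = ∇ div u − Δu` and Green's representation `Γ ∗ Δu = u` — Majda–Bertozzi's
"`v = −curl ψ`, `curl curl ψ = ∇ div ψ − Δψ`" for the vector potential `ψ = −Γ ∗ ω`, here without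
the assumption `div u = 0`. [cite: MajdaBertozziCUP2002, §2.4.1 Prop. 2.16 with (2.92)–(2.96) (p. 63–64 of the held text)] -/
theorem apply_eq_biotSavart_curl_apply_add_convolution (hu : ContDiff ℝ ∞ u)
    (huc : HasCompactSupport u) (y : EuclideanSpace ℝ (Fin 3)) (i : Fin 3) :
    u y i = biotSavart (curl u) y i +
      ((fun x => fderiv ℝ (VectorCalculus.divergence u) x (EuclideanSpace.single i 1))
        ⋆[lsmul ℝ ℝ, volume] newtonKernel) y := by
  have h2 : ContDiff ℝ 2 u := hu.of_le two_le_infty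
  have hc1 : ContDiff ℝ 1 (curl u) := (contDiff_curl_infty hu).of_le one_le_infty
  have hcc : HasCompactSupport (curl u) := hasCompactSupport_curl huc
  set d : EuclideanSpace ℝ (Fin 3) → ℝ := VectorCalculus.divergence u with hd
  have hd1 : ContDiff ℝ 1 d := (contDiff_divergence_infty hu).of_le one_le_infty
  have hdc : HasCompactSupport d := hasCompactSupport_divergence_of huc
  -- the gradient of the divergence, in coordinates
  set G : EuclideanSpace ℝ (Fin 3) → EuclideanSpace ℝ (Fin 3) := fun x =>
    ∑ j, (fderiv ℝ d x (EuclideanSpace.single (j : Fin 3) (1 : ℝ))) •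
      (EuclideanSpace.single (j : Fin 3) (1 : ℝ)) with hG
  have hGc : Continuous G :=
    continuous_finsetSum _ fun j _ =>
      (((hd1.continuous_fderiv one_ne_zero).clm_apply continuous_const).smul continuous_const)
  have hGs : HasCompactSupport G := by
    refine (hdc.fderiv (𝕜 := ℝ)).mono fun x hx => ?_
    contrapose! hx
    simp only [mem_support, not_not] at hx ⊢
    simp [hG, hx]
  have hΔc : Continuous (Δ u) := (contDiff_laplacian (n := 0) (by exact h2)).continuous
  have hΔs : HasCompactSupport (Δ u) :=
    HasCompactSupport.of_support_subset_isCompact huc.isCompact fun x hx => by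
      by_contra h
      exact hx (laplacian_eq_zero_of_notMem_tsupport h)
  have iG : Integrable fun x => newtonKernel (y - x) • G x := integrable_newtonKernel_smul hGc hGs y
  have iΔ : Integrable fun x => newtonKernel (y - x) • (Δ u) x :=
    integrable_newtonKernel_smul hΔc hΔs y
  -- `K₃ ∗ curl u = -(Γ ∗ G) + Γ ∗ Δu = u - Γ ∗ G`
  have hBS : biotSavart (curl u) y = u y - ∫ x, newtonKernel (y - x) • G x := by
    rw [biotSavart_eq_neg_integral_newtonKernel_smul_curl hc1 hcc y]
    have e : (fun x => newtonKernel (y - x) • curl (curl u) x) =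
        fun x => newtonKernel (y - x) • G x - newtonKernel (y - x) • (Δ u) x := by
      funext x
      rw [curl_curl_eq_sum_fderiv_divergence_sub_laplacian h2 x, smul_sub]
    rw [e, integral_sub iG iΔ, integral_newtonKernel_smul_laplacian h2 huc y]
    abel
  -- the `i`-th component of `Γ ∗ G` is `N[∂ᵢ d]`
  have hGi : ∀ x, G x i = fderiv ℝ d x (EuclideanSpace.single i 1) := fun x => by
    simp [hG, Finset.sum_apply, Pi.single_apply, mul_ite, Finset.mem_univ]
  have hcomp : (∫ x, newtonKernel (y - x) • G x) i =
      ((fun x => fderiv ℝ d x (EuclideanSpace.single i 1)) ⋆[lsmul ℝ ℝ, volume] newtonKernel) y := by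
    rw [integral_apply_fin_three iG i, convolution_newtonKernel_apply']
    refine integral_congr_ae (Eventually.of_forall fun x => ?_)
    simp only [PiLp.smul_apply, smul_eq_mul, hGi]
  rw [hBS, ← hcomp]
  simp

/-- The components of the Biot–Savart velocity of the curl of a test field are `C^∞`
(`(K₃ ∗ curl u)ᵢ = uᵢ − N[∂ᵢ div u]`). [folklore] -/
private theorem contDiff_biotSavart_curl_apply (hu : ContDiff ℝ ∞ u) (huc : HasCompactSupport u)
    (i : Fin 3) : ContDiff ℝ ∞ fun y => biotSavart (curl u) y i := by
  have hdi : ContDiff ℝ ∞ fun x => fderiv ℝ (VectorCalculus.divergence u) x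
      (EuclideanSpace.single i 1) := contDiff_fderiv_apply_const (contDiff_divergence_infty hu) _
  have hdic : HasCompactSupport fun x => fderiv ℝ (VectorCalculus.divergence u) x
      (EuclideanSpace.single i 1) :=
    hasCompactSupport_fderiv_apply_const (hasCompactSupport_divergence_of huc) _
  have e : (fun y => biotSavart (curl u) y i) = fun y => u y i -
      ((fun x => fderiv ℝ (VectorCalculus.divergence u) x (EuclideanSpace.single i 1))
        ⋆[lsmul ℝ ℝ, volume] newtonKernel) y := by
    funext y
    rw [apply_eq_biotSavart_curl_apply_add_convolution hu huc y i]
    ring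
  rw [e]
  exact (contDiff_apply_coord hu i).sub (contDiff_convolution_newtonKernel hdi hdic)

/-- **The derivative of the Helmholtz decomposition of a test field**: for `u ∈ C^∞_c(ℝ³; ℝ³)`,
`(∂ᵥu)ᵢ(x) = (∂ᵥ(K₃ ∗ curl u))ᵢ(x) + N[∂ᵥ∂ᵢ div u](x)` (the derivative falls on the smooth
source of the Newtonian potential). [cite: MajdaBertozziCUP2002, §2.4.1 Prop. 2.16–2.17 with (2.92)–(2.96) (p. 63–65 of the held text)] -/
theorem fderiv_apply_eq_fderiv_biotSavart_curl_add (hu : ContDiff ℝ ∞ u)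
    (huc : HasCompactSupport u) (x v : EuclideanSpace ℝ (Fin 3)) (i : Fin 3) :
    fderiv ℝ u x v i = fderiv ℝ (biotSavart (curl u)) x v i +
      ((fun t => fderiv ℝ (fun s => fderiv ℝ (VectorCalculus.divergence u) s
          (EuclideanSpace.single i 1)) t v) ⋆[lsmul ℝ ℝ, volume] newtonKernel) x := by
  set dᵢ : EuclideanSpace ℝ (Fin 3) → ℝ := fun s => fderiv ℝ (VectorCalculus.divergence u) s
    (EuclideanSpace.single i 1) with hdᵢ
  have hdi : ContDiff ℝ ∞ dᵢ := contDiff_fderiv_apply_const (contDiff_divergence_infty hu) _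
  have hdic : HasCompactSupport dᵢ :=
    hasCompactSupport_fderiv_apply_const (hasCompactSupport_divergence_of huc) _
  have hBSd : DifferentiableAt ℝ (biotSavart (curl u)) x :=
    differentiableAt_euclidean.2 fun j =>
      ((contDiff_biotSavart_curl_apply hu huc j).differentiable (by simp)) x
  have hud : DifferentiableAt ℝ (fun y => u y i) x :=
    ((contDiff_apply_coord hu i).differentiable (by simp)) x
  have hNd : DifferentiableAt ℝ (dᵢ ⋆[lsmul ℝ ℝ, volume] newtonKernel) x :=
    ((contDiff_convolution_newtonKernel hdi hdic).differentiable (by simp)) x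
  have e : (fun y => biotSavart (curl u) y i) =
      fun y => u y i - (dᵢ ⋆[lsmul ℝ ℝ, volume] newtonKernel) y := by
    funext y
    rw [apply_eq_biotSavart_curl_apply_add_convolution hu huc y i]
    ring
  rw [← fderiv_apply_coord hBSd v i, e, fderiv_fun_sub hud hNd, sub_apply,
    fderiv_apply_coord (hu.differentiable (by simp) x) v i,
    fderiv_convolution_newtonKernel_apply (hdi.of_le one_le_infty) hdic x v]
  ring

/-- **The `L^p` div–curl estimate for test fields, entrywise.** For `1 < p < ∞` there is
`C = C(p)` such that for every `u ∈ C^∞_c(ℝ³; ℝ³)`, every `|v| ≤ 1` and every component `i`,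
`‖(∂ᵥu)ᵢ‖_{L^p} ≤ C (‖curl u‖_{L^p} + ‖div u‖_{L^p})`: the Helmholtz decomposition
`∂ᵥuᵢ = (∂ᵥ K₃ ∗ curl u)ᵢ + N[∂ᵥ∂ᵢ div u]` and the Calderón–Zygmund bounds for the two singular
integrals (Majda–Bertozzi §4.2: `‖P_N f‖_{L^p} ≤ c_p ‖f‖_{L^p}` for `f ∈ C₀^∞`, `1 < p < ∞`). [cite: MajdaBertozziCUP2002, §4.2 display before Lemma 4.6 (p. 144 of the held text) with §2.4.1 (2.92)–(2.96)] -/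
theorem exists_eLpNorm_fderiv_apply_le_curl_add_divergence {p : ℝ≥0∞} (hp1 : 1 < p)
    (hp2 : p < ⊤) :
    ∃ C : ℝ≥0, ∀ u : EuclideanSpace ℝ (Fin 3) → EuclideanSpace ℝ (Fin 3), ContDiff ℝ ∞ u →
      HasCompactSupport u → ∀ v : EuclideanSpace ℝ (Fin 3), ‖v‖ ≤ 1 → ∀ i : Fin 3,
        eLpNorm (fun x => fderiv ℝ u x v i) p volume ≤
          C * (eLpNorm (curl u) p volume + eLpNorm (VectorCalculus.divergence u) p volume) := by
  obtain ⟨C₁, hC₁⟩ := exists_eLpNorm_fderiv_biotSavart_apply_le_norm hp1 hp2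
  obtain ⟨C₂, hC₂⟩ := exists_eLpNorm_convolution_mixed_fderiv2_newtonKernel_le hp1 hp2
  refine ⟨max C₁ C₂, fun u hu huc v hv i => ?_⟩
  have hp1' : 1 ≤ p := hp1.le
  have hsingle : ‖(EuclideanSpace.single i (1 : ℝ) : EuclideanSpace ℝ (Fin 3))‖ ≤ 1 := by
    rw [PiLp.norm_single, norm_one]
  set d : EuclideanSpace ℝ (Fin 3) → ℝ := VectorCalculus.divergence u with hd
  have hdi : ContDiff ℝ ∞ d := contDiff_divergence_infty hu
  have hdc : HasCompactSupport d := hasCompactSupport_divergence_of huc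
  -- the two pieces
  set f : EuclideanSpace ℝ (Fin 3) → ℝ := fun x => fderiv ℝ (biotSavart (curl u)) x v i with hf
  set g : EuclideanSpace ℝ (Fin 3) → ℝ := (fun t => fderiv ℝ (fun s => fderiv ℝ d s
    (EuclideanSpace.single i 1)) t v) ⋆[lsmul ℝ ℝ, volume] newtonKernel with hg
  have e : (fun x => fderiv ℝ u x v i) = fun x => f x + g x :=
    funext fun x => fderiv_apply_eq_fderiv_biotSavart_curl_add hu huc x v i
  have hgm : AEStronglyMeasurable g volume :=
    (contDiff_convolution_newtonKernel (contDiff_fderiv_fderiv_apply hdi _ _)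
      (hasCompactSupport_fderiv_fderiv_apply hdc _ _)).continuous.aestronglyMeasurable
  have hDum : Continuous fun x => fderiv ℝ u x v i :=
    (EuclideanSpace.proj i).continuous.comp
      ((hu.continuous_fderiv (by simp)).clm_apply continuous_const)
  have hfm : AEStronglyMeasurable f volume := by
    have ef : f = fun x => fderiv ℝ u x v i - g x := by
      funext x
      have := congrFun e x
      simp only at this
      rw [this]
      ring
    rw [ef]
    exact hDum.aestronglyMeasurable.sub hgm
  have hbf : eLpNorm f p volume ≤ C₁ * eLpNorm (curl u) p volume :=
    hC₁ (curl u) (contDiff_curl_infty hu) (hasCompactSupport_curl huc) v hv i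
  have hbg : eLpNorm g p volume ≤ C₂ * eLpNorm d p volume := hC₂ _ v hsingle hv d hdi hdc
  rw [e]
  calc eLpNorm (fun x => f x + g x) p volume
      ≤ eLpNorm f p volume + eLpNorm g p volume := eLpNorm_add_le hfm hgm hp1'
    _ ≤ C₁ * eLpNorm (curl u) p volume + C₂ * eLpNorm d p volume := add_le_add hbf hbg
    _ ≤ (max C₁ C₂ : ℝ≥0) * eLpNorm (curl u) p volume +
          (max C₁ C₂ : ℝ≥0) * eLpNorm d p volume := by
        gcongr
        · exact_mod_cast le_max_left C₁ C₂
        · exact_mod_cast le_max_right C₁ C₂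
    _ = (max C₁ C₂ : ℝ≥0) * (eLpNorm (curl u) p volume + eLpNorm d p volume) := (mul_add _ _ _).symm

/-- **The `L^p` div–curl estimate for test fields**: for `1 < p < ∞` there is `C = C(p)` with
`‖Du‖_{L^p(ℝ³)} ≤ C (‖curl u‖_{L^p} + ‖div u‖_{L^p})` (operator norm of the full gradient) for
all `u ∈ C^∞_c(ℝ³; ℝ³)` — the entrywise estimate summed over the nine entries
(`‖T‖ ≤ ∑ₖ ∑ₘ |(T eₖ)ₘ|`). [cite: MajdaBertozziCUP2002, §4.2 display before Lemma 4.6 (p. 144 of the held text) and Prop. 10.6 (p. 359)] -/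
theorem exists_eLpNorm_fderiv_le_curl_add_divergence {p : ℝ≥0∞} (hp1 : 1 < p) (hp2 : p < ⊤) :
    ∃ C : ℝ≥0, ∀ u : EuclideanSpace ℝ (Fin 3) → EuclideanSpace ℝ (Fin 3), ContDiff ℝ ∞ u →
      HasCompactSupport u →
        eLpNorm (fderiv ℝ u) p volume ≤
          C * (eLpNorm (curl u) p volume + eLpNorm (VectorCalculus.divergence u) p volume) := by
  obtain ⟨C, hC⟩ := exists_eLpNorm_fderiv_apply_le_curl_add_divergence hp1 hp2
  refine ⟨9 * C, fun u hu huc => ?_⟩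
  have hp1' : 1 ≤ p := hp1.le
  have hsingle : ∀ l : Fin 3, ‖(EuclideanSpace.single l (1 : ℝ) : EuclideanSpace ℝ (Fin 3))‖ ≤ 1 :=
    fun l => by rw [PiLp.norm_single, norm_one]
  set S : ℝ≥0∞ := eLpNorm (curl u) p volume + eLpNorm (VectorCalculus.divergence u) p volume
    with hS
  set g : Fin 3 → Fin 3 → EuclideanSpace ℝ (Fin 3) → ℝ := fun l i x =>
    fderiv ℝ u x (EuclideanSpace.single l (1 : ℝ)) i with hg
  have hDc : Continuous (fderiv ℝ u) := hu.continuous_fderiv (by simp)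
  have hgm : ∀ l i, AEStronglyMeasurable (fun x => ‖g l i x‖) volume := fun l i =>
    ((EuclideanSpace.proj i).continuous.comp
      (hDc.clm_apply continuous_const)).norm.aestronglyMeasurable
  have hgb : ∀ l i, eLpNorm (fun x => ‖g l i x‖) p volume ≤ C * S := fun l i => by
    rw [eLpNorm_norm]
    exact hC u hu huc _ (hsingle l) i
  have hpt : ∀ x, ‖fderiv ℝ u x‖ ≤ (∑ l, ∑ i, fun x => ‖g l i x‖) x := fun x => by
    simp only [Finset.sum_apply, hg, Real.norm_eq_abs]
    exact opNorm_le_sum_abs_coord _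
  calc eLpNorm (fderiv ℝ u) p volume
      ≤ eLpNorm (∑ l, ∑ i, fun x => ‖g l i x‖) p volume := eLpNorm_mono_real hpt
    _ ≤ ∑ l, eLpNorm (∑ i, fun x => ‖g l i x‖) p volume :=
        eLpNorm_sum_le (fun l _ => Finset.aestronglyMeasurable_sum _ fun i _ => hgm l i) hp1'
    _ ≤ ∑ l, ∑ i, eLpNorm (fun x => ‖g l i x‖) p volume :=
        Finset.sum_le_sum fun l _ => eLpNorm_sum_le (fun i _ => hgm l i) hp1'
    _ ≤ ∑ _l : Fin 3, ∑ _i : Fin 3, (C : ℝ≥0∞) * S :=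
        Finset.sum_le_sum fun l _ => Finset.sum_le_sum fun i _ => hgb l i
    _ = (9 * C : ℝ≥0) * S := by
        simp only [Finset.sum_const, Finset.card_univ, Fintype.card_fin]
        push_cast
        ring


/-- An `L^p` triangle inequality with a scalar weight: if `‖f‖ ≤ ‖g‖ + c‖h‖` pointwise with
`c ≥ 0`, then `‖f‖_{L^p} ≤ ‖g‖_{L^p} + c‖h‖_{L^p}`. [folklore] -/
private theorem eLpNorm_le_of_norm_le_add_mul {X : Type*} [MeasurableSpace X] {μ : Measure X}
    {F G H : Type*} [NormedAddCommGroup F] [NormedAddCommGroup G] [NormedAddCommGroup H]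
    {f : X → F} {g : X → G} {h : X → H} {c : ℝ} (hc : 0 ≤ c)
    (hg : AEStronglyMeasurable g μ) (hh : AEStronglyMeasurable h μ) {p : ℝ≥0∞} (hp : 1 ≤ p)
    (hle : ∀ x, ‖f x‖ ≤ ‖g x‖ + c * ‖h x‖) :
    eLpNorm f p μ ≤ eLpNorm g p μ + ENNReal.ofReal c * eLpNorm h p μ := by
  calc eLpNorm f p μ ≤ eLpNorm ((fun x => ‖g x‖) + fun x => c * ‖h x‖) p μ :=
        eLpNorm_mono_real fun x => by simpa only [Pi.add_apply] using hle x
    _ ≤ eLpNorm (fun x => ‖g x‖) p μ + eLpNorm (fun x => c * ‖h x‖) p μ :=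
        eLpNorm_add_le hg.norm (hh.norm.const_mul c) hp
    _ = eLpNorm g p μ + ENNReal.ofReal c * eLpNorm h p μ := by
        rw [eLpNorm_norm, show (fun x => c * ‖h x‖) = c • fun x => ‖h x‖ from rfl,
          eLpNorm_const_smul, eLpNorm_norm, Real.enorm_eq_ofReal hc]

/-- The norm of the gradient is the norm of the derivative. [folklore] -/
private theorem norm_gradient_eq {f : EuclideanSpace ℝ (Fin 3) → ℝ} (x : EuclideanSpace ℝ (Fin 3)) :
    ‖gradient f x‖ = ‖fderiv ℝ f x‖ := by
  unfold gradient
  exact (InnerProductSpace.toDual ℝ (EuclideanSpace ℝ (Fin 3))).symm.norm_map _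

/-- **`‖∇u‖_{L^p} ≤ C_p ‖curl u‖_{L^p}` for smooth divergence-free fields with an `L^s` tail**,
`1 < p ≤ s < ∞`, `3(1/p − 1/s) < 1`: there is `C = C(p)` (the constant of the test-field estimate,
independent of `s`) such that every `u ∈ C^∞(ℝ³; ℝ³)` with `div u = 0` and `‖u‖_{L^s} < ∞`
satisfies `‖Du‖_{L^p(ℝ³)} ≤ C ‖curl u‖_{L^p(ℝ³)}` (both sides may be infinite). Proof: the
test-field estimate `exists_eLpNorm_fderiv_le_curl_add_divergence` for the truncations
`wₙ = χ(·/(n+1)) u` (`div wₙ = ⟪u, ∇χₙ⟫`, `curl wₙ = χₙ curl u + curlCLM(∇χₙ ⊗ u)`,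
`χₙ Du = Dwₙ − ∇χₙ ⊗ u`, `|∇χₙ| ≤ C₁/(n+1)` supported in `|x| ≤ 2(n+1)`), Hölder on that ball
(`‖1_B u‖_p ≤ ‖u‖_s |B|^{1/p−1/s}`, so the error is `O((n+1)^{3(1/p−1/s)−1}) → 0`) and Fatou's
lemma in `L^p`. The case `s = 2 ≥ p > 6/5` is the finite-energy class, `s = 6 ≥ p > 2` the class
`∇u ∈ L²` (Sobolev); Majda–Bertozzi (11.9): "`‖∇v‖_{L^p} ≤ C_p ‖ω‖_{L^p}`". [cite: MajdaBertozziCUP2002, Ch. 11 (11.9) (p. 367 of the held text) with Prop. 10.6 (p. 359) and §4.2 (p. 144)] -/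
theorem exists_eLpNorm_fderiv_le_curl_of_isDivFree_of_eLpNorm_lt_top {p s : ℝ≥0∞} (hp1 : 1 < p)
    (hps : p ≤ s) (hs : s < ⊤) (hgap : 3 * (1 / p.toReal - 1 / s.toReal) < 1) :
    ∃ C : ℝ≥0, ∀ u : EuclideanSpace ℝ (Fin 3) → EuclideanSpace ℝ (Fin 3), ContDiff ℝ ∞ u →
      VectorCalculus.IsDivFree u → eLpNorm u s volume < ⊤ →
        eLpNorm (fderiv ℝ u) p volume ≤ C * eLpNorm (curl u) p volume := by
  have hp2 : p < ⊤ := lt_of_le_of_lt hps hs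
  obtain ⟨C, hC⟩ := exists_eLpNorm_fderiv_le_curl_add_divergence hp1 hp2
  obtain ⟨C₁, hC₁0, hC₁⟩ := exists_norm_fderiv_cutoff_le (E := EuclideanSpace ℝ (Fin 3))
  refine ⟨C, fun u hu hdiv hus => ?_⟩
  have hp1' : 1 ≤ p := hp1.le
  have hud : Differentiable ℝ u := hu.differentiable (by simp)
  have huc : Continuous u := hu.continuous
  have hDuc : Continuous (fderiv ℝ u) := hu.continuous_fderiv (by simp)
  have hcurlc : Continuous (curl u) := continuous_curl (hu.of_le one_le_infty)
  -- the Hölder exponent gap `e = 1/p - 1/s ≥ 0`, `3e < 1`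
  set e : ℝ := 1 / p.toReal - 1 / s.toReal with hedef
  have hp0r : 0 < p.toReal := ENNReal.toReal_pos (lt_trans zero_lt_one hp1).ne' hp2.ne
  have he0 : 0 ≤ e := by
    rw [hedef, sub_nonneg]
    exact one_div_le_one_div_of_le hp0r (ENNReal.toReal_mono hs.ne hps)
  -- the truncations `wₙ = χ(·/(n+1)) u`
  set R : ℕ → ℝ := fun n => (n : ℝ) + 1 with hRdef
  have hR : ∀ n, 0 < R n := fun n => by positivity
  set χ : ℕ → EuclideanSpace ℝ (Fin 3) → ℝ := fun n => cutoff (R n) with hχ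
  have hχd : ∀ n, ContDiff ℝ ∞ (χ n) := fun n => contDiff_cutoff _
  have hχdiff : ∀ n x, DifferentiableAt ℝ (χ n) x := fun n x =>
    (hχd n).differentiable (by simp) x
  have hχc : ∀ n, HasCompactSupport (χ n) := fun n => hasCompactSupport_cutoff (hR n)
  have hχ1 : ∀ n x, |χ n x| ≤ 1 := fun n x => abs_cutoff_le_one _ _
  have hDχ : ∀ n x, ‖fderiv ℝ (χ n) x‖ ≤ C₁ / R n := fun n x => hC₁ (R n) (hR n) x
  set w : ℕ → EuclideanSpace ℝ (Fin 3) → EuclideanSpace ℝ (Fin 3) := fun n x => χ n x • u x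
    with hw
  have hwd : ∀ n, ContDiff ℝ ∞ (w n) := fun n => (hχd n).smul hu
  have hwc : ∀ n, HasCompactSupport (w n) := fun n => (hχc n).smul_right
  -- the balls carrying `∇χₙ` and the localised field `Uₙ = 1_{B̄(0,2Rₙ)} u`
  set B : ℕ → Set (EuclideanSpace ℝ (Fin 3)) := fun n => closedBall 0 (2 * R n) with hB
  set U : ℕ → EuclideanSpace ℝ (Fin 3) → EuclideanSpace ℝ (Fin 3) := fun n => (B n).indicator u
    with hUdef
  have mU : ∀ n, AEStronglyMeasurable (U n) volume := fun n =>
    huc.aestronglyMeasurable.indicator measurableSet_closedBall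
  have hT : ∀ n x, ‖(fderiv ℝ (χ n) x).smulRight (u x)‖ ≤ C₁ / R n * ‖U n x‖ := by
    intro n x
    rw [norm_smulRight_apply]
    by_cases hx : x ∈ B n
    · rw [hUdef]; dsimp only; rw [indicator_of_mem hx]
      exact mul_le_mul_of_nonneg_right (hDχ n x) (norm_nonneg _)
    · have hx' : 2 * R n < ‖x‖ := by
        rw [hB] at hx
        simpa [mem_closedBall, dist_zero_right] using hx
      rw [show fderiv ℝ (χ n) x = 0 from fderiv_cutoff_eq_zero_of_gt (hR n) hx', norm_zero,
        zero_mul]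
      positivity
  -- volume of the balls and the Hölder bound `‖Uₙ‖_p ≤ ‖u‖_s |Bₙ|^e`
  set v₁ : ℝ≥0∞ := volume (ball (0 : EuclideanSpace ℝ (Fin 3)) 1) with hv₁
  have hv₁t : v₁ < ⊤ := measure_ball_lt_top
  have hvolB : ∀ n, volume (B n) = ENNReal.ofReal ((2 * R n) ^ 3) * v₁ := fun n => by
    have h := Measure.addHaar_closedBall (volume : Measure (EuclideanSpace ℝ (Fin 3)))
      (0 : EuclideanSpace ℝ (Fin 3)) (by positivity : 0 ≤ 2 * R n)
    rw [finrank_euclideanSpace_fin] at h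
    exact h
  set M : ℝ≥0∞ := v₁ ^ e * eLpNorm u s volume with hM
  have hMt : M < ⊤ := ENNReal.mul_lt_top (ENNReal.rpow_lt_top_of_nonneg he0 hv₁t.ne) hus
  set δ : ℕ → ℝ := fun n => C₁ / R n * ((2 * R n) ^ 3) ^ e with hδ
  have hδ0 : ∀ n, 0 ≤ δ n := fun n => by positivity
  have hUp : ∀ n, eLpNorm (U n) p volume ≤ ENNReal.ofReal (((2 * R n) ^ 3) ^ e) * M := by
    intro n
    have h1 : eLpNorm (U n) p volume = eLpNorm u p (volume.restrict (B n)) := by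
      rw [hUdef]; dsimp only
      rw [eLpNorm_indicator_eq_eLpNorm_restrict measurableSet_closedBall]
    rw [h1]
    calc eLpNorm u p (volume.restrict (B n))
        ≤ eLpNorm u s (volume.restrict (B n)) *
            (volume.restrict (B n)) univ ^ (1 / p.toReal - 1 / s.toReal) :=
          eLpNorm_le_eLpNorm_mul_rpow_measure_univ hps huc.aestronglyMeasurable
      _ ≤ eLpNorm u s volume * (volume (B n)) ^ e := by
          rw [Measure.restrict_apply_univ, ← hedef]
          exact mul_le_mul' (eLpNorm_mono_measure u Measure.restrict_le_self) le_rfl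
      _ = ENNReal.ofReal (((2 * R n) ^ 3) ^ e) * M := by
          rw [hvolB, ENNReal.mul_rpow_of_nonneg _ _ he0,
            ENNReal.ofReal_rpow_of_nonneg (by positivity) he0, hM]
          ring
  have hQ : ∀ n, ENNReal.ofReal (C₁ / R n) * eLpNorm (U n) p volume ≤ ENNReal.ofReal (δ n) * M := by
    intro n
    calc ENNReal.ofReal (C₁ / R n) * eLpNorm (U n) p volume
        ≤ ENNReal.ofReal (C₁ / R n) * (ENNReal.ofReal (((2 * R n) ^ 3) ^ e) * M) :=
          mul_le_mul' le_rfl (hUp n)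
      _ = ENNReal.ofReal (δ n) * M := by
          rw [← mul_assoc, ← ENNReal.ofReal_mul (div_nonneg hC₁0 (hR n).le)]
  -- the error terms
  set ε : ℕ → ℝ≥0∞ := fun n =>
    ((C : ℝ≥0∞) * (ENNReal.ofReal ‖curlCLM‖ + 1) + 1) * (ENNReal.ofReal (δ n) * M) with hε
  -- Step 1: `‖χₙ Du‖_{L^p} ≤ C ‖curl u‖_{L^p} + εₙ`
  have hstep : ∀ n, eLpNorm (fun x => χ n x • fderiv ℝ u x) p volume ≤
      C * eLpNorm (curl u) p volume + ε n := by
    intro n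
    have hcR : 0 ≤ C₁ / R n := div_nonneg hC₁0 (hR n).le
    -- (a) `div wₙ = ⟪u, ∇χₙ⟫ = Dχₙ(u)`
    have hdiv_w : ∀ x, ‖VectorCalculus.divergence (w n) x‖ ≤ C₁ / R n * ‖U n x‖ := by
      intro x
      have e1 : VectorCalculus.divergence (w n) x = ⟪u x, gradient (χ n) x⟫ := by
        show VectorCalculus.divergence (fun y => χ n y • u y) x = _
        rw [divergence_smul_apply (hχdiff n x) (hud x), hdiv x, mul_zero, zero_add]
      rw [e1]
      calc ‖⟪u x, gradient (χ n) x⟫‖ ≤ ‖u x‖ * ‖gradient (χ n) x‖ := norm_inner_le_norm _ _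
        _ = ‖(fderiv ℝ (χ n) x).smulRight (u x)‖ := by
            rw [norm_gradient_eq, norm_smulRight_apply, mul_comm]
        _ ≤ C₁ / R n * ‖U n x‖ := hT n x
    -- (b) `curl wₙ = χₙ curl u + curlCLM (∇χₙ ⊗ u)`
    have hcurl_w : ∀ x, ‖curl (w n) x‖ ≤ ‖curl u x‖ + ‖curlCLM‖ * (C₁ / R n) * ‖U n x‖ := by
      intro x
      have e1 : curl (w n) x = χ n x • curl u x +
          curlCLM ((fderiv ℝ (χ n) x).smulRight (u x)) := by
        show curl (fun y => χ n y • u y) x = _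
        exact curl_smul (hχdiff n x) (hud x)
      rw [e1]
      calc ‖χ n x • curl u x + curlCLM ((fderiv ℝ (χ n) x).smulRight (u x))‖
          ≤ ‖χ n x • curl u x‖ + ‖curlCLM ((fderiv ℝ (χ n) x).smulRight (u x))‖ :=
            norm_add_le _ _
        _ ≤ 1 * ‖curl u x‖ + ‖curlCLM‖ * (C₁ / R n * ‖U n x‖) := by
            refine add_le_add ?_ ((le_opNorm _ _).trans ?_)
            · rw [norm_smul, Real.norm_eq_abs]
              exact mul_le_mul_of_nonneg_right (hχ1 n x) (norm_nonneg _)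
            · exact mul_le_mul_of_nonneg_left (hT n x) (norm_nonneg _)
        _ = ‖curl u x‖ + ‖curlCLM‖ * (C₁ / R n) * ‖U n x‖ := by ring
    -- (c) `χₙ Du = Dwₙ − ∇χₙ ⊗ u`
    have hχDu : ∀ x, ‖χ n x • fderiv ℝ u x‖ ≤ ‖fderiv ℝ (w n) x‖ + C₁ / R n * ‖U n x‖ := by
      intro x
      have e1 : χ n x • fderiv ℝ u x =
          fderiv ℝ (w n) x - (fderiv ℝ (χ n) x).smulRight (u x) := by
        rw [show fderiv ℝ (w n) x = fderiv ℝ (fun y => χ n y • u y) x from rfl,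
          fderiv_fun_smul (hχdiff n x) (hud x)]
        abel
      rw [e1]
      exact (norm_sub_le _ _).trans (add_le_add le_rfl (hT n x))
    -- measurability
    have mDw : AEStronglyMeasurable (fderiv ℝ (w n)) volume :=
      ((hwd n).continuous_fderiv (by simp)).aestronglyMeasurable
    have mcurl : AEStronglyMeasurable (curl u) volume := hcurlc.aestronglyMeasurable
    -- `L^p` bounds
    have h1 : eLpNorm (fun x => χ n x • fderiv ℝ u x) p volume ≤
        eLpNorm (fderiv ℝ (w n)) p volume + ENNReal.ofReal (C₁ / R n) * eLpNorm (U n) p volume :=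
      eLpNorm_le_of_norm_le_add_mul hcR mDw (mU n) hp1' hχDu
    have h2 : eLpNorm (fderiv ℝ (w n)) p volume ≤
        C * (eLpNorm (curl (w n)) p volume + eLpNorm (VectorCalculus.divergence (w n)) p volume) :=
      hC (w n) (hwd n) (hwc n)
    have h3 : eLpNorm (curl (w n)) p volume ≤
        eLpNorm (curl u) p volume +
          ENNReal.ofReal (‖curlCLM‖ * (C₁ / R n)) * eLpNorm (U n) p volume :=
      eLpNorm_le_of_norm_le_add_mul (by positivity) mcurl (mU n) hp1' hcurl_w
    have h4 : eLpNorm (VectorCalculus.divergence (w n)) p volume ≤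
        ENNReal.ofReal (C₁ / R n) * eLpNorm (U n) p volume := by
      have h := eLpNorm_le_of_norm_le_add_mul (f := VectorCalculus.divergence (w n))
        (g := fun _ : EuclideanSpace ℝ (Fin 3) => (0 : ℝ)) hcR aestronglyMeasurable_const (mU n) hp1'
        (fun x => by rw [norm_zero, zero_add]; exact hdiv_w x)
      have h0 : eLpNorm (fun _ : EuclideanSpace ℝ (Fin 3) => (0 : ℝ)) p volume = 0 := eLpNorm_zero
      rw [h0, zero_add] at h
      exact h
    have h3' : ENNReal.ofReal (‖curlCLM‖ * (C₁ / R n)) * eLpNorm (U n) p volume =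
        ENNReal.ofReal ‖curlCLM‖ * (ENNReal.ofReal (C₁ / R n) * eLpNorm (U n) p volume) := by
      rw [ENNReal.ofReal_mul (norm_nonneg curlCLM), mul_assoc]
    set Q : ℝ≥0∞ := ENNReal.ofReal (C₁ / R n) * eLpNorm (U n) p volume with hQdef
    calc eLpNorm (fun x => χ n x • fderiv ℝ u x) p volume
        ≤ eLpNorm (fderiv ℝ (w n)) p volume + Q := h1
      _ ≤ C * (eLpNorm (curl (w n)) p volume + eLpNorm (VectorCalculus.divergence (w n)) p volume) +
            Q := by gcongr
      _ ≤ C * ((eLpNorm (curl u) p volume + ENNReal.ofReal ‖curlCLM‖ * Q) + Q) + Q := by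
          rw [← h3']
          gcongr
      _ = C * eLpNorm (curl u) p volume + ((C : ℝ≥0∞) * (ENNReal.ofReal ‖curlCLM‖ + 1) + 1) * Q := by
          ring
      _ ≤ C * eLpNorm (curl u) p volume + ε n :=
          add_le_add le_rfl (mul_le_mul' le_rfl (hQ n))
  -- Step 2: `εₙ → 0` (`δₙ = C₁ 2^{3e} Rₙ^{3e-1} → 0` since `3e < 1`, and `M < ∞`)
  have hδt : Tendsto δ atTop (𝓝 0) := by
    have hδ' : ∀ n, δ n = C₁ * (2 : ℝ) ^ (3 * e) * (R n) ^ (3 * e - 1) := by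
      intro n
      have hR0 : 0 ≤ R n := (hR n).le
      show C₁ / R n * ((2 * R n) ^ 3) ^ e = _
      rw [show ((2 * R n) ^ 3 : ℝ) = (2 * R n) ^ (3 : ℝ) by norm_cast, ← Real.rpow_mul (by positivity),
        Real.mul_rpow (by norm_num) hR0, Real.rpow_sub_one (hR n).ne']
      field_simp
    rw [show δ = fun n => C₁ * (2 : ℝ) ^ (3 * e) * (R n) ^ (3 * e - 1) from funext hδ']
    have hRt : Tendsto R atTop atTop := by
      rw [hRdef]
      exact tendsto_natCast_atTop_atTop.atTop_add tendsto_const_nhds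
    have hpow : Tendsto (fun n => (R n) ^ (3 * e - 1)) atTop (𝓝 0) := by
      have hneg : 0 < -(3 * e - 1) := by rw [hedef] at *; linarith
      have h := (tendsto_rpow_neg_atTop hneg).comp hRt
      rw [neg_neg] at h
      exact h
    simpa using hpow.const_mul (C₁ * (2 : ℝ) ^ (3 * e))
  have hεt : Tendsto ε atTop (𝓝 0) := by
    have h0 : Tendsto (fun n => ENNReal.ofReal (δ n)) atTop (𝓝 0) := by
      rw [← ENNReal.ofReal_zero]
      exact ENNReal.tendsto_ofReal hδt
    have h1 : Tendsto (fun n => ENNReal.ofReal (δ n) * M) atTop (𝓝 0) := by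
      simpa using ENNReal.Tendsto.mul_const h0 (Or.inr hMt.ne)
    have hKt : ((C : ℝ≥0∞) * (ENNReal.ofReal ‖curlCLM‖ + 1) + 1) ≠ ⊤ := by
      finiteness
    simpa [hε] using ENNReal.Tendsto.const_mul h1 (Or.inr hKt)
  -- Step 3: Fatou in `L^p` along `χₙ Du → Du`
  have hlim : ∀ x, Tendsto (fun n => χ n x • fderiv ℝ u x) atTop (𝓝 (fderiv ℝ u x)) := fun x => by
    have h := (tendsto_cutoff_natCast_add_one x).smul_const (fderiv ℝ u x)
    rwa [one_smul] at h
  have hmeas : ∀ n, AEStronglyMeasurable (fun x => χ n x • fderiv ℝ u x) volume := fun n =>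
    (((hχd n).continuous).smul hDuc).aestronglyMeasurable
  have hFatou : eLpNorm (fderiv ℝ u) p volume ≤
      liminf (fun n => eLpNorm (fun x => χ n x • fderiv ℝ u x) p volume) atTop :=
    MeasureTheory.Lp.eLpNorm_lim_le_liminf_eLpNorm hmeas (fderiv ℝ u) (Eventually.of_forall hlim)
  have hB' : Tendsto (fun n => (C : ℝ≥0∞) * eLpNorm (curl u) p volume + ε n) atTop
      (𝓝 ((C : ℝ≥0∞) * eLpNorm (curl u) p volume)) := by
    simpa using tendsto_const_nhds.add hεt
  calc eLpNorm (fderiv ℝ u) p volume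
      ≤ liminf (fun n => eLpNorm (fun x => χ n x • fderiv ℝ u x) p volume) atTop := hFatou
    _ ≤ liminf (fun n => (C : ℝ≥0∞) * eLpNorm (curl u) p volume + ε n) atTop :=
        liminf_le_liminf (Eventually.of_forall hstep)
    _ = C * eLpNorm (curl u) p volume := hB'.liminf_eq

/-- **`‖∇u‖_{L^p} ≤ C_p ‖curl u‖_{L^p}` for smooth divergence-free fields in `L^p(ℝ³)`**,
`1 < p < ∞`: there is `C = C(p)` such that every `u ∈ C^∞(ℝ³; ℝ³)` with `div u = 0` and
`‖u‖_{L^p} < ∞` satisfies `‖Du‖_{L^p(ℝ³)} ≤ C ‖curl u‖_{L^p(ℝ³)}` (both sides may be infinite).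
This is Majda–Bertozzi's "`‖∇v‖_{L^p} ≤ C_p ‖ω‖_{L^p}`" ((11.9), from the Calderón–Zygmund
inequality Prop. 10.6 for the singular integral `∇K₃ ∗ ω`) for fields that are not
compactly supported: the test-field estimate `exists_eLpNorm_fderiv_le_curl_add_divergence`
applied to the truncations `wₙ = χ(·/(n+1)) u` (`div wₙ = ⟪u, ∇χₙ⟫`,
`curl wₙ = χₙ curl u + curlCLM(∇χₙ ⊗ u)`, `χₙ Du = Dwₙ − ∇χₙ ⊗ u`, `|∇χₙ| ≤ C₁/(n+1)`), so that
`‖χₙ Du‖_{L^p} ≤ C ‖curl u‖_{L^p} + O(‖u‖_{L^p}/(n+1))`, and Fatou's lemma in `L^p` (the case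
`s = p` of `exists_eLpNorm_fderiv_le_curl_of_isDivFree_of_eLpNorm_lt_top`). [cite: MajdaBertozziCUP2002, Ch. 11 (11.9) (p. 367 of the held text) with Prop. 10.6 (p. 359) and §4.2 (p. 144)] -/
theorem exists_eLpNorm_fderiv_le_curl_of_isDivFree {p : ℝ≥0∞} (hp1 : 1 < p) (hp2 : p < ⊤) :
    ∃ C : ℝ≥0, ∀ u : EuclideanSpace ℝ (Fin 3) → EuclideanSpace ℝ (Fin 3), ContDiff ℝ ∞ u →
      VectorCalculus.IsDivFree u → eLpNorm u p volume < ⊤ →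
        eLpNorm (fderiv ℝ u) p volume ≤ C * eLpNorm (curl u) p volume :=
  exists_eLpNorm_fderiv_le_curl_of_isDivFree_of_eLpNorm_lt_top hp1 le_rfl hp2
    (by rw [sub_self, mul_zero]; exact zero_lt_one)

end DivCurlLp

end Literature.Analysis.FluidPDE
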